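import Summits.ResolutionOfSingularities.ResolutionOfSingularities.Theorems.PurelyInseparableDim4E2OfCJSAssemblyPrime
import Summits.ResolutionOfSingularities.ResolutionOfSingularities.Theorems.PurelyInseparableDim4PolarParity
import HarnessLib

/-!
# F4-I(p,p) MODULO CJS THM 6.40, ALL PRIMES IN ONE SENTENCE: `NoWideTrap p p ⟸ F-111` for EVERY prime `p`, and
# modulo F-111 the cell's question `NoIsolatedTrapQuestion` IS K2(p) for the primes `p ≥ 5` (cell `res-dim4-pi`)

[OURS · counted 0 · AI work weaker than expert review.]  Cell `res-dim4-pi` (D-0157 DOOR 2), seat `res-dim4-p-3` g2.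
Pure COMPOSITION of landed theorems — no new mathematics.  NOTHING here proves K2(p) for any `p ≥ 5`, the
Cossart–Jannsen–Saito theorem (LNM 2270, Thm 6.40 = the named fact `KeyTheorem640_char_localized_isolated`, F-111,
INPUT only), F4-C, or resolution of singularities in dimension ≥ 4 / characteristic `p`.

The p-program (desk WORD #66/#70) closed `E2OfCJS.noWideTrap_of_KeyTheorem640 (p) (hp3 : 3 ≤ p)` (res-dim4-p-2 g2,
p671312): for every prime `p ≥ 3`, no infinite isolated chain on the WIDE floor (`ord₀ = p`, `ē = 2`) of the purely
inseparable frame `z^p + F(x₀,…,x₃)` GIVEN CJS Thm 6.40.  This file removes the last side condition and states the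
residual once:

* §1 `noWideTrap_prime_of_KeyTheorem640` — EVERY prime: at `p = 2` the wide statement is the tree's UNCONDITIONAL
  theorem `PolarParity.noWideTrap_two` (F4-I(2,2) = `WildConesBridge.noIsolatedTrap_two_two`, Milnor route), so
  CJS's characteristic hypothesis (F1) «char ≥ dim/2 + 1», the only place `3 ≤ p` entered, costs nothing.
* §2 `noIsolatedTrap_iff_noAboveFloorTrap_prime_of_KeyTheorem640` — MODULO F-111, F4-I(p,p) (`NoIsolatedTrap p p`) is
  EXACTLY K2(p) (`RidgeBudget.NoAboveFloorTrap p p`: no infinite isolated chain avoiding the floor `ord₀ = p`), by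
  the exact splitting `RidgeBudget.noIsolatedTrap_iff_residual` (narrow third (N1)/FT(p,p) and wide third are in).
* §3 the small primes: K2(2) (`PolarParity.noAboveFloorTrap_two`) and K2(3) (`RidgeBudget.noAboveFloorTrap_three`)
  are tree theorems, hence F4-I(2,2) unconditionally and F4-I(3,3) ⟸ F-111 (agreeing with p669181 / p671312).
* §4 THE SENTENCE: `noIsolatedTrapQuestion_iff_of_KeyTheorem640` — given CJS Thm 6.40,
  `NoIsolatedTrapQuestion` (F4-I for all primes, `…Scope`) ↔ `∀ p prime, 5 ≤ p → NoAboveFloorTrap p p`;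
  the unconditional half `noAboveFloorTrap_of_noIsolatedTrapQuestion` and the sufficiency
  `noIsolatedTrapQuestion_of_KeyTheorem640_of_K2`.  K2(p), `p ≥ 5`, is the K2 lane's open letter (res-dim4-p-12 g2
  `ResCone.noAboveFloorTrap_iff_noLocatedTrap`, p670526: located constant-`(d, e_G)` traps).

bears_on: LADDER-RESOLUTION:D157-DOOR2 (res-dim4-pi · F4-I ⟸ F-111 ∧ K2(p ≥ 5)).  Supports
stmt-ResolutionOfSingularities-16155 (helper).
-/

set_option linter.dupNamespace false -- mandated namespace of this single-conjunct summit

noncomputable section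

namespace Summit.ResolutionOfSingularities.ResolutionOfSingularities.Theorems.PIDim4

namespace E2OfCJS

open Literature.AlgebraicGeometry.CossartJannsenSaito2020
open RidgeBudget (NoWideTrap NoAboveFloorTrap)

/-! ## §1 Every prime: the wide floor trap is excluded by CJS Thm 6.40 (and at `p = 2` by the tree alone) -/

/-- **`NoWideTrap p p ⟸ CJS Thm 6.40` for EVERY prime `p`.**  For `p ≥ 3` this is the p-program's assembly
`noWideTrap_of_KeyTheorem640` (p671312); at `p = 2` the statement is the tree's unconditional theorem
`PolarParity.noWideTrap_two` (F4-I(2,2), `WildConesBridge.noIsolatedTrap_two_two`), so the hypothesis is not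
even used there. [OURS · conditional on the NAMED PUBLISHED FACT only] [cite: CossartJannsenSaito2020, Thm. 6.40] -/
theorem noWideTrap_prime_of_KeyTheorem640 (p : ℕ) [hp : Fact p.Prime]
    (hK640 : KeyTheorem640_char_localized_isolated.{0}) : NoWideTrap p p := by
  rcases (Nat.Prime.two_le hp.out).eq_or_lt with h2 | h3
  · subst h2
    exact PolarParity.noWideTrap_two
  · exact noWideTrap_of_KeyTheorem640 p (by omega) hK640

/-! ## §2 Modulo F-111, F4-I(p,p) is K2(p) exactly -/

/-- **MODULO CJS THM 6.40, F4-I(p,p) ⟺ K2(p)** (EVERY prime `p`): given `KeyTheorem640_char_localized_isolated`,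
`NoIsolatedTrap p p ↔ NoAboveFloorTrap p p` — the exact splitting `noIsolatedTrap_iff_residual` with its wide
conjunct discharged by §1.  This is res-dim4-p-1 g2's `noIsolatedTrap_iff_noAboveFloorTrap_of_KeyTheorem640`
(p672077) with its hypothesis `3 ≤ p` REMOVED. [OURS · conditional on the NAMED PUBLISHED FACT only]
[cite: CossartJannsenSaito2020, Thm. 6.40] -/
theorem noIsolatedTrap_iff_noAboveFloorTrap_prime_of_KeyTheorem640 (p : ℕ) [Fact p.Prime]
    (hK640 : KeyTheorem640_char_localized_isolated.{0}) : NoIsolatedTrap p p ↔ NoAboveFloorTrap p p := by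
  rw [RidgeBudget.noIsolatedTrap_iff_residual p]
  exact ⟨fun h => h.2, fun h => ⟨noWideTrap_prime_of_KeyTheorem640 p hK640, h⟩⟩

/-- **F4-I(p,p) ⟸ F-111 ∧ K2(p)**, EVERY prime `p`: res-dim4-p-11 g2's `noIsolatedTrap_of_KeyTheorem640_of_K2`
(p672093, the name of record) = res-dim4-p-1 g2's `noIsolatedTrap_of_KeyTheorem640_of_noAboveFloorTrap` (p672077)
with the hypothesis `3 ≤ p` REMOVED. [OURS · conditional on the NAMED PUBLISHED FACT and on the OURS letter K2(p)]
[cite: CossartJannsenSaito2020, Thm. 6.40] -/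
theorem noIsolatedTrap_prime_of_KeyTheorem640_of_noAboveFloorTrap (p : ℕ) [Fact p.Prime]
    (hK640 : KeyTheorem640_char_localized_isolated.{0}) (hK2 : NoAboveFloorTrap p p) : NoIsolatedTrap p p :=
  (noIsolatedTrap_iff_noAboveFloorTrap_prime_of_KeyTheorem640 p hK640).mpr hK2

/-! ## §3 The small primes: K2(2) and K2(3) are theorems of the tree -/

/-- **K2(p) for `p ≤ 3`**: `NoAboveFloorTrap 2 2` (`PolarParity.noAboveFloorTrap_two`: along a `Step0 2` chain every
state has `ord₀ = 2`) and `NoAboveFloorTrap 3 3` (`RidgeBudget.noAboveFloorTrap_three`: order dichotomy + K2(3) =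
the band result `FreeTailProof.noIsolatedBandRun3`). [OURS · glue] [folklore] -/
theorem noAboveFloorTrap_of_le_three (p : ℕ) [hp : Fact p.Prime] (h3 : p ≤ 3) : NoAboveFloorTrap p p := by
  have h2 := Nat.Prime.two_le hp.out
  interval_cases p
  · exact PolarParity.noAboveFloorTrap_two
  · exact RidgeBudget.noAboveFloorTrap_three

/-- **F4-I(p,p) ⟸ F-111 for `p ≤ 3`** (F4-I(2,2) in fact unconditionally — `WildConesBridge.noIsolatedTrap_two_two`;
F4-I(3,3) ⟸ F-111 agrees with `noIsolatedTrap_three_three_of_KeyTheorem640`, p669181).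
[OURS · conditional on the NAMED PUBLISHED FACT only] [cite: CossartJannsenSaito2020, Thm. 6.40] -/
theorem noIsolatedTrap_of_KeyTheorem640_of_le_three (p : ℕ) [Fact p.Prime] (h3 : p ≤ 3)
    (hK640 : KeyTheorem640_char_localized_isolated.{0}) : NoIsolatedTrap p p :=
  noIsolatedTrap_prime_of_KeyTheorem640_of_noAboveFloorTrap p hK640 (noAboveFloorTrap_of_le_three p h3)

/-! ## §4 The sentence: modulo CJS Thm 6.40, the cell's F4-I question is K2(p) for the primes `p ≥ 5` -/

/-- The unconditional half: F4-I for all primes gives K2(p) for all primes. [OURS · adapter] [folklore] -/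
theorem noAboveFloorTrap_of_noIsolatedTrapQuestion (h : NoIsolatedTrapQuestion) (p : ℕ) (hp : p.Prime) :
    NoAboveFloorTrap p p :=
  RidgeBudget.noAboveFloorTrap_of_noIsolatedTrap p p (h p hp)

/-- **SUFFICIENCY: CJS Thm 6.40 ∧ (K2(p) for every prime `p ≥ 5`) ⇒ F4-I for every prime.**  At `p = 2, 3` K2 is
the tree's (§3); at `p ≥ 5` it is the hypothesis. [OURS · conditional on the NAMED PUBLISHED FACT and on the OURS
letters K2(p), p ≥ 5] [cite: CossartJannsenSaito2020, Thm. 6.40] -/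
theorem noIsolatedTrapQuestion_of_KeyTheorem640_of_K2 (hK640 : KeyTheorem640_char_localized_isolated.{0})
    (hK2 : ∀ p : ℕ, p.Prime → 5 ≤ p → NoAboveFloorTrap p p) : NoIsolatedTrapQuestion := by
  intro p hp
  haveI : Fact p.Prime := ⟨hp⟩
  refine noIsolatedTrap_prime_of_KeyTheorem640_of_noAboveFloorTrap p hK640 ?_
  by_cases h3 : p ≤ 3
  · exact noAboveFloorTrap_of_le_three p h3
  · have h4 : p ≠ 4 := by rintro rfl; exact absurd hp (by decide)
    exact hK2 p hp (by omega)

/-- **THE SENTENCE.**  Given CJS Thm 6.40 (`KeyTheorem640_char_localized_isolated`, F-111), the cell's question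
F4-I (`NoIsolatedTrapQuestion`: for every prime `p`, no infinite ISOLATED chain of point blow-ups of the purely
inseparable frame `z^p + F(x₀,…,x₃)` in characteristic `p`) is EQUIVALENT to K2(p) for the primes `p ≥ 5`
(`RidgeBudget.NoAboveFloorTrap p p`: no infinite isolated chain AVOIDING the floor `ord₀ F = p`).  Wide floor:
CJS (all `p`, §1); narrow floor: (N1)/FT(p,p) (tree); above floor at `p = 2, 3`: tree (§3).
[OURS · conditional on the NAMED PUBLISHED FACT only] [cite: CossartJannsenSaito2020, Thm. 6.40] -/
theorem noIsolatedTrapQuestion_iff_of_KeyTheorem640 (hK640 : KeyTheorem640_char_localized_isolated.{0}) :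
    NoIsolatedTrapQuestion ↔ ∀ p : ℕ, p.Prime → 5 ≤ p → NoAboveFloorTrap p p :=
  ⟨fun h p hp _ => noAboveFloorTrap_of_noIsolatedTrapQuestion h p hp,
    noIsolatedTrapQuestion_of_KeyTheorem640_of_K2 hK640⟩

/-- The same with K2 asked at every prime (the small primes being free). [OURS · conditional on the NAMED
PUBLISHED FACT only] [cite: CossartJannsenSaito2020, Thm. 6.40] -/
theorem noIsolatedTrapQuestion_iff_forall_noAboveFloorTrap_of_KeyTheorem640
    (hK640 : KeyTheorem640_char_localized_isolated.{0}) :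
    NoIsolatedTrapQuestion ↔ ∀ p : ℕ, p.Prime → NoAboveFloorTrap p p :=
  ⟨fun h p hp => noAboveFloorTrap_of_noIsolatedTrapQuestion h p hp,
    fun h => noIsolatedTrapQuestion_of_KeyTheorem640_of_K2 hK640 fun p hp _ => h p hp⟩

/-- Instance of record: F4-I(5,5) ⟸ F-111 ∧ K2(5). [OURS · conditional] [cite: CossartJannsenSaito2020, Thm. 6.40] -/
theorem noIsolatedTrap_five_five_of_KeyTheorem640_of_K2 (hK640 : KeyTheorem640_char_localized_isolated.{0})
    (hK2 : NoAboveFloorTrap 5 5) : NoIsolatedTrap 5 5 :=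
  haveI : Fact (Nat.Prime 5) := ⟨by norm_num⟩
  noIsolatedTrap_prime_of_KeyTheorem640_of_noAboveFloorTrap 5 hK640 hK2

end E2OfCJS

end Summit.ResolutionOfSingularities.ResolutionOfSingularities.Theorems.PIDim4

end
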